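import Literature.Probability.LatticeModels.FieldScalingLimit
import Literature.Probability.LatticeModels.HighDimTrivialityAssemblyProofs
import Literature.Probability.LatticeModels.IsingGibbsFlip
import Literature.MathematicalPhysics.QuantumFieldTheory.ContinuumLimitsTrivialityAssemblyProofs
import HarnessLib

/-!
# crit-ising.S13 for laws on `𝒮'(ℝᵈ)`: the infinite-volume form of `highDim_triviality`, proved

Proof companion of `Literature/Probability/LatticeModels/FieldScalingLimit.lean` for its
crit-ising.S13 triviality statement (theorems only: no definition, no statement and no named fact
is introduced or changed; the sibling `FieldScalingLimitProofs.lean` serves the Aizenman–Fernández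
magnetisation statement of the same file).

## Why a corrected form (provefact verdict `misstated`, 2026-08-15)

`Literature.Probability.LatticeModels.highDim_triviality` renders the triviality theorems
(Aizenman–Duminil-Copin, Ann. Math. 194 (2021) = arXiv:1912.07973, Thm 1.2, `d = 4`; Aizenman
1982, Fröhlich 1982, `d ≥ 5`) over the FINITE-VOLUME PLUS-boundary-condition measures
`isingMeasure (zdGraph d) (box d (L δ)) (β δ) 0 .plus` in the joint regime `δ L(δ) → ∞`. What is
printed (arXiv pagination): Def. 1.1 (p. 4) takes `T_{f,L} = Σ_L^{-1/2} ∑ₓ f(x/L) σₓ` in the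
double limit `lim_{L → ∞} lim_{R/L → ∞}` — the volume cutoff `Λ_R` is removed FIRST (§1.1, p. 3)
— so Thm 1.2 (p. 4) and its input Prop. 1.4 (p. 6, "for every `β ≤ β_c`") concern the
infinite-volume state `⟨·⟩_β`; likewise Aizenman 1982, (13.1) ("limits of infinite-volume lattice
approximants") and Panis 2023, Thm 5.5. No source treats finite volumes in a joint limit — the
"volume axis" on which the sibling renderings `ising4_triviality`, `phi44_triviality`,
`phi4_highDim_triviality` (`QuantumFieldTheory/ContinuumLimits`, "S24, scope") were restated on
2026-08-15 — and with `+` boundary conditions the approximating laws are not even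
(`⟨σₓ⟩⁺_{Λ;β,0} > 0`), so neither the printed estimates nor the printed centring argument ("by
flip symmetry", §6.3, p. 26) apply, while `IsGaussianField` demands `IsCentered`. (The remark in
that file's docstring, `finLatticeField_tail_tendsto`, concerns truncating the smearing sum of a
FIXED state, not replacing the state by a finite-volume Gibbs measure.)

## What is proved here

The same statement with that one change — zero-field DLR states `ν δ ∈ isingGibbsMeasures d (β δ) 0`
(a singleton for `β ≤ β_c`) in place of the plus boxes, everything else kept (any `ρ(δ)`, any
`0 ≤ β(δ) ≤ β_c`, smearing boxes with `δ L(δ) → ∞`, Schwartz test functions, generating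
functionals, the unused a-posteriori hypothesis `HasBoundedNondegenerateTwoPoint μ`):
`highDim_triviality_gibbs_of_five_le` (`d ≥ 5`, UNCONDITIONAL) and `highDim_triviality_gibbs`
(`d ≥ 4`, from the single named fact `panis_ursellFourSum_le_four` = Panis 2023, Cor. 1.8, the
`d = 4` logarithmic improvement of the tree diagram bound, ADC Thms 1.3/5.6), both through
`isGaussianField_of_tendstoInLaw_spinFieldLaw_gibbs`. The assembly is the remark printed after ADC
Prop. 1.4 (p. 6), at the level of laws: evenness of the DLR states gives centring; the summed
moment bound `abs_mgf_normalizedField_sub_exp_le_dlr`, transported to the law of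
`Φ_δ(f) = a T_{f,1/δ}`, `a = ρ δᵈ Σ_{1/δ}^{1/2}`, and the variance bounds feed
`isGaussian_of_tendstoInLaw_of_scaleBound`, whose Slutsky step pins the unknown scale `a²`.
Arbitrary `β(δ) ∈ [0, β_c]` (no window `L ≤ ξ(β)`) is legitimate because the uniformity in `β` is
derived in the tree (`HighDimTrivialityUniformProofs`). References: ADC 2021 = arXiv:1912.07973,
Def. 1.1, Thm 1.2 (p. 4), §1.3 (p. 5), Prop. 1.4 (p. 6), §6.3 (p. 26); Aizenman, CMP 86 (1982),
Prop. 10.1, (13.1); Panis, arXiv:2309.05797, Thm 5.5, Cor. 1.8. Mathlib: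
`HasCompactSupport.toSchwartzMap`, `ContDiffBump`, `tendsto_inv_nhdsGT_zero`, `integral_map`.
-/

noncomputable section

open scoped SchwartzMap NNReal
open MeasureTheory Filter Topology ProbabilityTheory
open Literature.MathematicalPhysics.QuantumLattice
open Literature.MathematicalPhysics.QuantumFieldTheory

namespace Literature.Probability.LatticeModels

variable {d : ℕ}

/-! ### The box-smeared spin field and the full-lattice field of `Sweep1` -/

/-- The two embeddings `ℤᵈ → ℝᵈ` of the tree (`siteVec` of `Sweep1`, `siteToE` of
`LatticeScalarField`) coincide. [folklore] -/
theorem siteVec_eq_siteToE (x : Site d) : siteVec x = siteToE x := rfl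

/-- **The smearing box is invisible once it contains the support.** For `δ > 0`, `f` vanishing
outside `[-r, r]ᵈ` and a box `{−L, …, L}ᵈ` with `r ≤ δ L`, the box-smeared spin field
`Φ_δ(f) = ρ δᵈ ∑_{x ∈ box d L} f(δx) σₓ` (`spinField`) is the full-lattice field
`ρ δᵈ ∑_{x ∈ ℤᵈ} f(δx) σₓ` of `Sweep1` (`smearedSpin`; ADC 2021, (1.5)/(1.7)). [folklore] -/
theorem spinField_box_apply_eq_smearedSpin {δ : ℝ} (hδ : 0 < δ) {L : ℕ} (ρ : ℝ) {r : ℝ}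
    (f : 𝓢(EuclideanSpace ℝ (Fin d), ℝ)) (hfr : ∀ x, f x ≠ 0 → ∀ i, |x i| ≤ r)
    (hrL : r ≤ δ * L) (σ : SpinConfig (Site d)) :
    spinField (box d L) δ ρ σ f = smearedSpin ρ δ f σ := by
  have hsupp : (Function.support fun x : Site d => f (δ • siteVec x) * spinAt x σ) ⊆
      ↑(box d L) := fun x hx => by
    rw [Function.mem_support] at hx
    have hfx : f (δ • siteVec x) ≠ 0 := fun h => hx (by rw [h, zero_mul])
    rw [Finset.mem_coe, mem_box]
    intro i
    have h := hfr _ hfx i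
    rw [PiLp.smul_apply, siteVec_apply, smul_eq_mul, abs_mul, abs_of_pos hδ] at h
    have h' : |((x i : ℤ) : ℝ)| ≤ (L : ℝ) := le_of_mul_le_mul_left (h.trans hrL) hδ
    rw [abs_le] at h'
    exact ⟨by exact_mod_cast h'.1, by exact_mod_cast h'.2⟩
  unfold spinField smearedSpin
  rw [finLatticeField_apply, finsum_eq_sum_of_support_subset _ hsupp, Finset.mul_sum]
  refine Finset.sum_congr rfl fun x _ => ?_
  rw [siteVec_eq_siteToE]
  ring

/-- Exponential moments of the box-smeared spin field, which is bounded by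
`∑_{x ∈ Λ} |ρ δᵈ f(δx)|` (`|σₓ| = 1`), exist under any finite measure. [folklore] -/
theorem integrable_exp_mul_spinField_apply (μ : Measure (SpinConfig (Site d))) [IsFiniteMeasure μ]
    (Λ : Finset (Site d)) (δ ρ : ℝ) (f : 𝓢(EuclideanSpace ℝ (Fin d), ℝ)) (w : ℝ) :
    Integrable (fun σ => Real.exp (w * spinField Λ δ ρ σ f)) μ := by
  set M : ℝ := ∑ x ∈ Λ, |ρ * δ ^ d * f (δ • siteToE x)|
  have hbd : ∀ σ, |spinField Λ δ ρ σ f| ≤ M := fun σ => by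
    unfold spinField
    rw [finLatticeField_apply]
    refine (Finset.abs_sum_le_sum_abs _ _).trans (le_of_eq (Finset.sum_congr rfl fun x _ => ?_))
    rw [show ρ * δ ^ d * spinAt x σ * f (δ • siteToE x) =
      (ρ * δ ^ d * f (δ • siteToE x)) * spinAt x σ by ring, abs_mul, abs_spinAt, mul_one]
  have hmeas : Measurable fun σ : SpinConfig (Site d) => spinField Λ δ ρ σ f :=
    (measurable_eval f).comp (measurable_spinField Λ δ ρ)
  refine Integrable.of_bound
    ((Real.continuous_exp.measurable.comp (hmeas.const_mul w)).aestronglyMeasurable)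
    (Real.exp (|w| * M)) (Eventually.of_forall fun σ => ?_)
  rw [Real.norm_eq_abs, Real.abs_exp]
  exact Real.exp_le_exp.mpr ((le_abs_self _).trans
    ((abs_mul _ _).le.trans (mul_le_mul_of_nonneg_left (hbd σ) (abs_nonneg w))))

/-- Integrals of functions of the marginal `ω(f)` under the law of the box-smeared spin field are
integrals over spin configurations. [folklore] -/
theorem integral_spinFieldLaw_eval (μ : Measure (SpinConfig (Site d))) (Λ : Finset (Site d))
    (δ ρ : ℝ) (f : 𝓢(EuclideanSpace ℝ (Fin d), ℝ)) {F : ℝ → ℝ} (hF : Continuous F) :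
    ∫ ω, F (ω f) ∂(spinFieldLaw μ Λ δ ρ) = ∫ σ, F (spinField Λ δ ρ σ f) ∂μ := by
  unfold spinFieldLaw
  exact integral_map (measurable_spinField Λ δ ρ).aemeasurable
    (hF.measurable.comp (measurable_eval f)).aestronglyMeasurable

/-- Integrability of functions of the marginal `ω(f)` under the law of the box-smeared spin field
is integrability over spin configurations. [folklore] -/
theorem integrable_spinFieldLaw_eval_iff (μ : Measure (SpinConfig (Site d))) (Λ : Finset (Site d))
    (δ ρ : ℝ) (f : 𝓢(EuclideanSpace ℝ (Fin d), ℝ)) {F : ℝ → ℝ} (hF : Continuous F) :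
    Integrable (fun ω : FieldConfig (EuclideanSpace ℝ (Fin d)) => F (ω f)) (spinFieldLaw μ Λ δ ρ) ↔
      Integrable (fun σ => F (spinField Λ δ ρ σ f)) μ := by
  unfold spinFieldLaw
  exact integrable_map_measure (hF.measurable.comp (measurable_eval f)).aestronglyMeasurable
    (measurable_spinField Λ δ ρ).aemeasurable

/-! ### Zero-field DLR states up to `β_c`: flip invariance, block variance, change of scale -/

/-- **The zero-field DLR states at `0 ≤ β ≤ β_c` (`d ≥ 3`) are flip invariant**: `𝒢(β, 0)` is a
singleton (`hasUniqueGibbsMeasure_of_lt_criticalBeta_holds`, `hasUniqueGibbsMeasure_criticalBeta_holds`)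
and is mapped to itself by the global flip `σ ↦ -σ` (`isGibbsMeasure_map_neg`). This is the
"flip symmetry `⟨T_{f,L}(σ)^{2n+1}⟩_β = 0`" of Aizenman–Duminil-Copin 2021, §6.3 (p. 26), at the
level of the state. [cite: AizenmanDuminilCopinAnnals2021, arXiv:1912.07973 §6.3 (p. 26)] -/
theorem measurePreserving_neg_of_mem_isingGibbsMeasures (hd : 3 ≤ d) {β : ℝ} (hβ : 0 ≤ β)
    (hβc : β ≤ criticalBeta d) {μ : Measure (SpinConfig (Site d))}
    (hμ : μ ∈ isingGibbsMeasures d β 0) :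
    MeasurePreserving (Neg.neg : SpinConfig (Site d) → SpinConfig (Site d)) μ μ := by
  have huniq : HasUniqueGibbsMeasure (isingSpecification (zdGraph d) β 0) := by
    rcases hβc.lt_or_eq with hlt | heq
    · exact hasUniqueGibbsMeasure_of_lt_criticalBeta_holds (by omega) hβ hlt
    · rw [heq]
      exact hasUniqueGibbsMeasure_criticalBeta_holds (by omega)
  exact ⟨measurable_neg, huniq.1 (isGibbsMeasure_map_neg (zdGraph d) β hμ) hμ⟩

/-- For a zero-field DLR state at `0 ≤ β ≤ β_c` (`d ≥ 3`), `Σ_L ≥ 1` for `L ≥ 0` (it is the free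
state, whose two-point function is non-negative, GKS I), so the block-spin normalisation
`Σ_L^{-1/2}` is not junk. [cite: FriedliVelenik2017, Thm. 3.20, eq. (3.21), p. 109] -/
theorem one_le_blockSpinVariance_of_mem_isingGibbsMeasures (hd : 3 ≤ d) {β : ℝ} (hβ : 0 ≤ β)
    (hβc : β ≤ criticalBeta d) {μ : Measure (SpinConfig (Site d))}
    (hμ : μ ∈ isingGibbsMeasures d β 0) {L : ℝ} (hL : 0 ≤ L) : 1 ≤ blockSpinVariance μ L := by
  haveI : IsProbabilityMeasure μ := hμ.1
  obtain ⟨-, hS⟩ := isingGibbsMeasure_twoPoint_of_facts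
    (fun {_} {_} => hasUniqueGibbsMeasure_of_lt_criticalBeta_holds)
    (fun {_} => hasUniqueGibbsMeasure_criticalBeta_holds)
    (fun d {_} => exists_freeMeasure_holds d 0) hd hβ hβc hμ
  refine one_le_blockSpinVariance μ (fun x y => ?_) hL
  rw [hS x y]
  exact twoPointFree_nonneg hasBoxLimit_isingCorr_free_holds
    (GKSInequalities.gks_one_holds (zdGraph d)) hβ _

/-- **Change of scale** (Aizenman–Duminil-Copin 2021, §1.2: any renormalisation is a multiple of
the block-spin one). For `d ≥ 3`, `0 ≤ β ≤ β_c`, `μ ∈ 𝒢(β, 0)`, `0 < δ` and a box containing the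
support (`f` vanishes outside `[-r, r]ᵈ`, `r ≤ δ L`): under `μ`,
`Φ_δ(f) = ρ δᵈ ∑_{x ∈ box d L} f(δx) σₓ = a · T_{f,1/δ}` with `a = ρ δᵈ Σ_{1/δ}(μ)^{1/2}`, hence
`∫ F(ω(f)) d(spinFieldLaw μ (box d L) δ ρ) = ∫ F(a T_{f,1/δ}) dμ` for continuous `F`.
[cite: AizenmanDuminilCopinAnnals2021, arXiv:1912.07973 §1.2 (p. 4), definition of T_{f,L}] -/
theorem integral_spinFieldLaw_eval_eq_normalizedField (hd : 3 ≤ d) {β : ℝ} (hβ : 0 ≤ β)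
    (hβc : β ≤ criticalBeta d) {μ : Measure (SpinConfig (Site d))}
    (hμ : μ ∈ isingGibbsMeasures d β 0) {δ : ℝ} (hδ : 0 < δ) {L : ℕ} (ρ : ℝ)
    {f : 𝓢(EuclideanSpace ℝ (Fin d), ℝ)} {r : ℝ} (hfr : ∀ x, f x ≠ 0 → ∀ i, |x i| ≤ r)
    (hrL : r ≤ δ * L) {F : ℝ → ℝ} (hF : Continuous F) :
    ∫ ω, F (ω f) ∂(spinFieldLaw μ (box d L) δ ρ) =
      ∫ σ, F ((ρ * δ ^ d * Real.sqrt (blockSpinVariance μ δ⁻¹)) * normalizedField μ δ⁻¹ f σ) ∂μ := by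
  have hS : Real.sqrt (blockSpinVariance μ δ⁻¹) ≠ 0 := (Real.sqrt_pos.2 (one_pos.trans_le
    (one_le_blockSpinVariance_of_mem_isingGibbsMeasures hd hβ hβc hμ (inv_pos.2 hδ).le))).ne'
  rw [integral_spinFieldLaw_eval μ (box d L) δ ρ f hF]
  refine integral_congr_ae (Eventually.of_forall fun σ => ?_)
  show F (spinField (box d L) δ ρ σ f) = _
  rw [spinField_box_apply_eq_smearedSpin hδ ρ f hfr hrL σ, smearedSpin_eq_mul_normalizedField μ hS]

/-- **The third display of ADC 2021 §6.3, transported to the law of the smeared field under an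
arbitrary renormalisation.** For `d ≥ 3`, `0 ≤ β ≤ β_c`, `μ ∈ 𝒢(β, 0)`, `0 < δ`, a box
`{−L, …, L}ᵈ` containing the support (`f` vanishes outside `[-r, r]ᵈ`, `r ≤ δ L`) and a bound
`⟨T_{|f|,1/δ}²⟩_μ ≤ C`: with the scale `s = a²`, `a = ρ δᵈ Σ_{1/δ}^{1/2}`, for all real `w`,
`|∫ e^{w ω(f)} − e^{w² ∫ ω(f)²/2}| ≤ (24 ‖f‖_∞⁴ S(μ; 1/δ, r)) · (s w²)² e^{C s w²/2}` under
`spinFieldLaw μ (box d L) δ ρ` — the shape `K G(s w²)` consumed by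
`isGaussian_of_tendstoInLaw_of_scaleBound`. Input: `abs_mgf_normalizedField_sub_exp_le_dlr`.
[cite: AizenmanDuminilCopinAnnals2021, arXiv:1912.07973 §6.3, third display (p. 26), with Prop. 1.4 (p. 6)] -/
theorem abs_mgf_spinFieldLaw_sub_exp_le (hd : 3 ≤ d) {β : ℝ} (hβ : 0 ≤ β)
    (hβc : β ≤ criticalBeta d) {μ : Measure (SpinConfig (Site d))}
    (hμ : μ ∈ isingGibbsMeasures d β 0) {δ : ℝ} (hδ : 0 < δ) {L : ℕ} (ρ : ℝ)
    {f : 𝓢(EuclideanSpace ℝ (Fin d), ℝ)} {r : ℝ} (hfr : ∀ x, f x ≠ 0 → ∀ i, |x i| ≤ r)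
    (hrL : r ≤ δ * L) {C : ℝ}
    (hC : ∫ σ, normalizedField μ δ⁻¹ (fun x => |f x|) σ ^ 2 ∂μ ≤ C) (w : ℝ) :
    |(∫ ω, Real.exp (w * ω f) ∂(spinFieldLaw μ (box d L) δ ρ)) -
        Real.exp (w ^ 2 * (∫ ω, (ω f) ^ 2 ∂(spinFieldLaw μ (box d L) δ ρ)) / 2)|
      ≤ (24 * (⨆ x, |f x|) ^ 4 * ursellFourSum μ δ⁻¹ r) *
          (((ρ * δ ^ d * Real.sqrt (blockSpinVariance μ δ⁻¹)) ^ 2 * w ^ 2) ^ 2 *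
            Real.exp (C * ((ρ * δ ^ d * Real.sqrt (blockSpinVariance μ δ⁻¹)) ^ 2 * w ^ 2) / 2)) := by
  haveI : IsProbabilityMeasure μ := hμ.1
  have h1 : ∫ ω, Real.exp (w * ω f) ∂(spinFieldLaw μ (box d L) δ ρ) = ∫ σ, Real.exp
      (w * (ρ * δ ^ d * Real.sqrt (blockSpinVariance μ δ⁻¹)) * normalizedField μ δ⁻¹ f σ) ∂μ := by
    rw [integral_spinFieldLaw_eval_eq_normalizedField hd hβ hβc hμ hδ ρ hfr hrL
      (F := fun t => Real.exp (w * t)) (by fun_prop)]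
    simp only [mul_assoc]
  have h2 : ∫ ω, (ω f) ^ 2 ∂(spinFieldLaw μ (box d L) δ ρ) =
      (ρ * δ ^ d * Real.sqrt (blockSpinVariance μ δ⁻¹)) ^ 2 *
        ∫ σ, normalizedField μ δ⁻¹ f σ ^ 2 ∂μ := by
    rw [integral_spinFieldLaw_eval_eq_normalizedField hd hβ hβc hμ hδ ρ hfr hrL
      (F := fun t => t ^ 2) (by fun_prop), ← integral_const_mul]
    simp only [mul_pow]
  rw [h1, h2]
  set a : ℝ := ρ * δ ^ d * Real.sqrt (blockSpinVariance μ δ⁻¹) with ha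
  have key := abs_mgf_normalizedField_sub_exp_le_dlr hd hβ hβc (inv_pos.2 hδ) hμ f.continuous
    hfr (w * a)
  rw [show (w * a) ^ 2 / 2 * ∫ σ, normalizedField μ δ⁻¹ f σ ^ 2 ∂μ =
      w ^ 2 * (a ^ 2 * ∫ σ, normalizedField μ δ⁻¹ f σ ^ 2 ∂μ) / 2 by ring] at key
  refine key.trans ?_
  have hpre : Real.exp ((w * a) ^ 2 / 2 * ∫ σ, normalizedField μ δ⁻¹ (fun x => |f x|) σ ^ 2 ∂μ) ≤
      Real.exp (C * (a ^ 2 * w ^ 2) / 2) := by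
    refine Real.exp_le_exp.2 ?_
    calc (w * a) ^ 2 / 2 * ∫ σ, normalizedField μ δ⁻¹ (fun x => |f x|) σ ^ 2 ∂μ
        ≤ (w * a) ^ 2 / 2 * C := mul_le_mul_of_nonneg_left hC (by positivity)
      _ = C * (a ^ 2 * w ^ 2) / 2 := by ring
  have hrest : 0 ≤ 24 * (⨆ x, |f x|) ^ 4 * ursellFourSum μ δ⁻¹ r * (w * a) ^ 4 := by
    have h4 : 0 ≤ (⨆ x, |f x|) ^ 4 := by positivity
    have hw : 0 ≤ (w * a) ^ 4 := by positivity
    have hS0 := ursellFourSum_nonneg μ δ⁻¹ r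
    positivity
  calc Real.exp ((w * a) ^ 2 / 2 * ∫ σ, normalizedField μ δ⁻¹ (fun x => |f x|) σ ^ 2 ∂μ) *
        (24 * (⨆ x, |f x|) ^ 4 * ursellFourSum μ δ⁻¹ r * (w * a) ^ 4)
      ≤ Real.exp (C * (a ^ 2 * w ^ 2) / 2) *
          (24 * (⨆ x, |f x|) ^ 4 * ursellFourSum μ δ⁻¹ r * (w * a) ^ 4) :=
        mul_le_mul_of_nonneg_right hpre hrest
    _ = (24 * (⨆ x, |f x|) ^ 4 * ursellFourSum μ δ⁻¹ r) *
          ((a ^ 2 * w ^ 2) ^ 2 * Real.exp (C * (a ^ 2 * w ^ 2) / 2)) := by ring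

/-! ### crit-ising.S13 for the infinite-volume states, at the level of laws on `𝒮'(ℝᵈ)` -/

/-- **Gaussianity of scaling limits in law of the Ising spin field smeared from zero-field DLR
states, `d ≥ 4`, granting the uniform smallness of the Ursell sum** (law-level crit-ising.S13;
Aizenman–Duminil-Copin 2021, Thm 1.2 with Def. 1.1 and the remark after Prop. 1.4, p. 6). For
`0 ≤ β(δ) ≤ β_c`, `ν_δ ∈ 𝒢(β(δ), 0)`, any `ρ(δ)`, boxes with `δ L(δ) → ∞`: every limit in law of
the laws of `Φ_δ(f) = ρ(δ) δᵈ ∑_{x ∈ box d (L δ)} f(δx) σₓ` as `δ → 0⁺` is a centred Gaussian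
field. `hU` — `sup {S(μ; L, r) : β ∈ [0, β_c], μ ∈ 𝒢(β, 0)} → 0` as `L → ∞` — is a theorem for
`d ≥ 5` (`ursellFourSum_uniformlySmall_of_five_le`) and follows from Panis's Cor. 1.8 for `d = 4`
(`ursellFourSum_uniformlySmall_of_panis_four`). Centring: evenness of the states
(`measurePreserving_neg_of_mem_isingGibbsMeasures`,
`isGaussianField_of_isGaussian_spinFieldLaw_limit_of_even`); Gaussianity:
`isGaussian_of_tendstoInLaw_of_scaleBound` with `abs_mgf_spinFieldLaw_sub_exp_le` and
`normalizedField_variance_bounds_holds` (the lower bound for one bump pins the unknown scale).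
No non-degeneracy of the limit is needed. [cite: AizenmanDuminilCopinAnnals2021, arXiv:1912.07973 Thm 1.2 with Def. 1.1 (p. 4), Prop. 1.4 and p. 6, §6.3 (p. 26)] -/
theorem isGaussianField_of_tendstoInLaw_spinFieldLaw_gibbs (hd : 4 ≤ d)
    (hU : ∀ r : ℝ, 1 ≤ r → ∀ ε : ℝ, 0 < ε → ∃ L₀ : ℝ, ∀ (β L : ℝ), 0 ≤ β → β ≤ criticalBeta d →
      L₀ ≤ L → ∀ μ ∈ isingGibbsMeasures d β 0, ursellFourSum μ L r ≤ ε)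
    {β ρ : ℝ → ℝ} {L : ℝ → ℕ} {ν : ℝ → Measure (SpinConfig (Site d))}
    {μ : Measure (FieldConfig (EuclideanSpace ℝ (Fin d)))}
    (hβ : ∀ δ, 0 < δ → 0 ≤ β δ ∧ β δ ≤ criticalBeta d)
    (hν : ∀ δ, 0 < δ → ν δ ∈ isingGibbsMeasures d (β δ) 0)
    (hL : Tendsto (fun δ : ℝ => δ * L δ) (𝓝[>] 0) atTop)
    (hlim : TendstoInLaw (fun δ => spinFieldLaw (ν δ) (box d (L δ)) δ (ρ δ)) (𝓝[>] 0) μ) :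
    IsGaussianField μ := by
  have hd3 : 3 ≤ d := by omega
  have hδpos : ∀ᶠ δ in 𝓝[>] (0 : ℝ), 0 < δ := eventually_mem_nhdsWithin
  have hδle : ∀ᶠ δ in 𝓝[>] (0 : ℝ), δ ≤ 1 :=
    (eventually_le_nhds one_pos).filter_mono nhdsWithin_le_nhds
  have hinv : Tendsto (fun δ : ℝ => δ⁻¹) (𝓝[>] (0 : ℝ)) atTop := tendsto_inv_nhdsGT_zero
  have hprob : ∀ᶠ δ in 𝓝[>] (0 : ℝ),
      IsProbabilityMeasure (spinFieldLaw (ν δ) (box d (L δ)) δ (ρ δ)) :=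
    hδpos.mono fun δ hδ => by haveI : IsProbabilityMeasure (ν δ) := (hν δ hδ).1; infer_instance
  have heven : ∀ᶠ δ in 𝓝[>] (0 : ℝ),
      MeasurePreserving (Neg.neg : SpinConfig (Site d) → SpinConfig (Site d)) (ν δ) (ν δ) :=
    hδpos.mono fun δ hδ =>
      measurePreserving_neg_of_mem_isingGibbsMeasures hd3 (hβ δ hδ).1 (hβ δ hδ).2 (hν δ hδ)
  refine isGaussianField_of_isGaussian_spinFieldLaw_limit_of_even
    (Λ := fun δ => box d (L δ)) heven hlim ?_
  refine isGaussian_of_tendstoInLaw_of_scaleBound hprob hlim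
    (s := fun δ => (ρ δ * δ ^ d * Real.sqrt (blockSpinVariance (ν δ) δ⁻¹)) ^ 2)
    (Eventually.of_forall fun δ => sq_nonneg _) ?_ ?_
  · -- (i) the lower variance bound for one bump `f₀` (ADC p. 6: `⟨T_{f,L}²⟩ ≥ c_f > 0`)
    let b : ContDiffBump (0 : EuclideanSpace ℝ (Fin d)) := ⟨1, 2, one_pos, one_lt_two⟩
    let f₀ : 𝓢(EuclideanSpace ℝ (Fin d), ℝ) := b.hasCompactSupport.toSchwartzMap b.contDiff
    have hf₀ : HasCompactSupport f₀ := b.hasCompactSupport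
    have hf₀ne : (f₀ : EuclideanSpace ℝ (Fin d) → ℝ) ≠ 0 := fun h => by
      have h1 : f₀ 0 = 1 := b.one_of_mem_closedBall (Metric.mem_closedBall_self one_pos.le)
      rw [h, Pi.zero_apply] at h1
      exact zero_ne_one h1
    obtain ⟨r₀, -, hfr₀⟩ := exists_cube_of_hasCompactSupport f₀ hf₀
    obtain ⟨c, L₀, hc, hlow⟩ :=
      (normalizedField_variance_bounds_holds hd f₀ f₀.continuous hf₀).2 (fun x => b.nonneg) hf₀ne
    refine ⟨f₀, c, hf₀, hc, ?_⟩
    filter_upwards [hδpos, hinv.eventually (eventually_ge_atTop L₀),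
      hL.eventually (eventually_ge_atTop r₀)] with δ hδ hδL₀ hδr₀
    show c * (ρ δ * δ ^ d * Real.sqrt (blockSpinVariance (ν δ) δ⁻¹)) ^ 2 ≤
      ∫ ω, (ω f₀) ^ 2 ∂(spinFieldLaw (ν δ) (box d (L δ)) δ (ρ δ))
    rw [integral_spinFieldLaw_eval_eq_normalizedField hd3 (hβ δ hδ).1 (hβ δ hδ).2 (hν δ hδ) hδ
      (ρ δ) hfr₀ hδr₀ (F := fun t => t ^ 2) (by fun_prop)]
    simp only [mul_pow]
    rw [integral_const_mul, mul_comm c]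
    exact mul_le_mul_of_nonneg_left
      (hlow (β δ) δ⁻¹ (hβ δ hδ).1 (hβ δ hδ).2 hδL₀ (ν δ) (hν δ hδ)) (by positivity)
  · -- (ii) the scale-covariant exponential-moment bound for every compactly supported `f`
    intro f hf
    obtain ⟨r, hr, hfr⟩ := exists_cube_of_hasCompactSupport f hf
    obtain ⟨C, hC⟩ := (normalizedField_variance_bounds_holds hd (fun x => |f x|)
      f.continuous.abs (hf.comp_left abs_zero)).1
    set C' : ℝ := max C 0 with hC'
    refine ⟨fun δ => 24 * (⨆ x, |f x|) ^ 4 * ursellFourSum (ν δ) δ⁻¹ r,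
      fun u => u ^ 2 * Real.exp (C' * u / 2), ?_, ?_, ?_, ?_⟩
    · -- `K(δ) → 0`: uniform smallness of the Ursell sum
      have hS0 : Tendsto (fun δ => ursellFourSum (ν δ) δ⁻¹ r) (𝓝[>] (0 : ℝ)) (𝓝 0) := by
        rw [Metric.tendsto_nhds]
        intro ε hε
        obtain ⟨L₀, hL₀⟩ := hU r hr (ε / 2) (half_pos hε)
        filter_upwards [hδpos, hinv.eventually (eventually_ge_atTop L₀)] with δ hδ hδL₀
        rw [Real.dist_eq, sub_zero, abs_of_nonneg (ursellFourSum_nonneg _ _ _)]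
        exact (hL₀ (β δ) δ⁻¹ (hβ δ hδ).1 (hβ δ hδ).2 hδL₀ (ν δ) (hν δ hδ)).trans_lt
          (half_lt_self hε)
      simpa using hS0.const_mul (24 * (⨆ x, |f x|) ^ 4)
    · intro u hu v _ huv -- `G(u) = u² e^{C' u/2}` is monotone on `[0, ∞)`
      have hu0 : 0 ≤ u := hu; have hC'0 : 0 ≤ C' := le_max_right _ _
      exact mul_le_mul (pow_le_pow_left₀ hu0 huv 2)
        (Real.exp_le_exp.2 (by nlinarith)) (Real.exp_pos _).le (sq_nonneg v)
    · -- exponential moments of the bounded lattice field exist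
      filter_upwards [hδpos] with δ hδ w
      haveI : IsProbabilityMeasure (ν δ) := (hν δ hδ).1
      exact (integrable_spinFieldLaw_eval_iff (ν δ) (box d (L δ)) δ (ρ δ) f
        (F := fun t => Real.exp (w * t)) (by fun_prop)).2
        (integrable_exp_mul_spinField_apply (ν δ) (box d (L δ)) δ (ρ δ) f w)
    · -- the bound itself
      filter_upwards [hδpos, hδle, hL.eventually (eventually_ge_atTop r)] with δ hδ hδ1 hδr w
      have hμ := hν δ hδ
      have hCf : ∫ σ, normalizedField (ν δ) δ⁻¹ (fun x => |f x|) σ ^ 2 ∂(ν δ) ≤ C' :=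
        (hC (β δ) δ⁻¹ (hβ δ hδ).1 (hβ δ hδ).2 ((one_le_inv₀ hδ).2 hδ1) (ν δ) hμ).trans
          (le_max_left _ _)
      exact abs_mgf_spinFieldLaw_sub_exp_le hd3 (hβ δ hδ).1 (hβ δ hδ).2 hμ hδ (ρ δ) hfr hδr hCf w

/-! ### The corrected statement of `highDim_triviality`: infinite-volume states -/

/-- **crit-ising.S13, `d ≥ 5`: the corrected form of `highDim_triviality`, UNCONDITIONAL**
(Aizenman, Comm. Math. Phys. 86 (1982), Prop. 10.1 with (13.1), "limits of infinite-volume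
lattice approximants … inevitably describe a Gaussian field"; Fröhlich 1982; Panis 2023, Thm 5.5 /
Thm 1.2, "for `β ≤ β_c`, every sub-sequential scaling limit of the model is Gaussian").
`Literature.Probability.LatticeModels.highDim_triviality` restricted to `d ≥ 5`, with the
finite-volume plus measure replaced by a zero-field DLR state `ν δ ∈ isingGibbsMeasures d (β δ) 0`
(module docstring); the hypothesis `HasBoundedNondegenerateTwoPoint μ` is kept for the shape and
not used. Proof: `isGaussianField_of_tendstoInLaw_spinFieldLaw_gibbs` with
`ursellFourSum_uniformlySmall_of_five_le`; no named fact enters (axioms `propext`,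
`Classical.choice`, `Quot.sound`). [cite: AizenmanCMP1982, Prop. 10.1 (p. 28) with (13.1) (p. 39)] [cite: Panis2023Triviality, Thm. 5.5 and Thm. 1.2] -/
theorem highDim_triviality_gibbs_of_five_le :
    ∀ (d : ℕ) (_ : 5 ≤ d),
      ∀ (ρ : ℝ → ℝ) (L : ℝ → ℕ) (β : ℝ → ℝ) (ν : ℝ → Measure (SpinConfig (Site d)))
        (μ : Measure (FieldConfig (EuclideanSpace ℝ (Fin d)))),
        (∀ δ, 0 ≤ β δ ∧ β δ ≤ criticalBeta d) →
        (∀ δ, 0 < δ → ν δ ∈ isingGibbsMeasures d (β δ) 0) →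
        Tendsto (fun δ : ℝ => δ * L δ) (𝓝[>] 0) atTop →
        TendstoInLaw (fun δ => spinFieldLaw (ν δ) (box d (L δ)) δ (ρ δ)) (𝓝[>] 0) μ →
        HasBoundedNondegenerateTwoPoint μ → IsGaussianField μ :=
  fun _ hd _ _ _ _ _ hβ hν hL hlim _ =>
    isGaussianField_of_tendstoInLaw_spinFieldLaw_gibbs (by omega)
      (fun _ hr _ hε => ursellFourSum_uniformlySmall_of_five_le hd hr hε)
      (fun δ _ => hβ δ) hν hL hlim

/-- **crit-ising.S13, `d ≥ 4`: the corrected form of `highDim_triviality`** (Aizenman–Duminil-Copin,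
Ann. Math. 194 (2021) = arXiv:1912.07973, Thm 1.2 (p. 4) with Def. 1.1 (p. 4, volume cutoff
removed first) and §1.3 (p. 5, "for `d = 4` any scaling limit of the critical Ising model is
Gaussian"), Prop. 1.4 (p. 6, infinite-volume state, `β ≤ β_c`); `d ≥ 5`: Aizenman 1982, Panis
2023). Literally `highDim_triviality` with the finite-volume plus-boundary-condition measure
`isingMeasure (zdGraph d) (box d (L δ)) (β δ) 0 .plus` replaced by a zero-field DLR state
`ν δ ∈ isingGibbsMeasures d (β δ) 0` — the setting of every source (module docstring: why the
plus-box rendering is not what is printed, verdict `misstated`). Proved from the single named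
fact `panis_ursellFourSum_le_four` (Panis 2023, Cor. 1.8: the `d = 4` logarithmic improvement of
the tree diagram bound, ADC Thms 1.3/5.6), entering at `d = 4` only; the hypothesis-free statement
is this theorem applied to `panis_ursellFourSum_le_four_holds` once that fact lands. [cite: AizenmanDuminilCopinAnnals2021, Thm 1.2 with Def. 1.1 (p. 4), §1.3 (p. 5), Prop. 1.4 (p. 6), §6.3 (p. 26)] [cite: Panis2023Triviality, Cor. 1.8 and Thm. 5.5] -/
theorem highDim_triviality_gibbs (hP₄ : panis_ursellFourSum_le_four) :
    ∀ (d : ℕ) (_ : 4 ≤ d),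
      ∀ (ρ : ℝ → ℝ) (L : ℝ → ℕ) (β : ℝ → ℝ) (ν : ℝ → Measure (SpinConfig (Site d)))
        (μ : Measure (FieldConfig (EuclideanSpace ℝ (Fin d)))),
        (∀ δ, 0 ≤ β δ ∧ β δ ≤ criticalBeta d) →
        (∀ δ, 0 < δ → ν δ ∈ isingGibbsMeasures d (β δ) 0) →
        Tendsto (fun δ : ℝ => δ * L δ) (𝓝[>] 0) atTop →
        TendstoInLaw (fun δ => spinFieldLaw (ν δ) (box d (L δ)) δ (ρ δ)) (𝓝[>] 0) μ →
        HasBoundedNondegenerateTwoPoint μ → IsGaussianField μ :=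
  fun _ hd _ _ _ _ _ hβ hν hL hlim _ =>
    isGaussianField_of_tendstoInLaw_spinFieldLaw_gibbs hd
      (fun r hr ε hε => ursellFourSum_uniformlySmall_of_panis_four hP₄ hd r hr ε hε)
      (fun δ _ => hβ δ) hν hL hlim

end Literature.Probability.LatticeModels

end
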